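import Mathlib
import Summits.Ventures.PercRepro2.HCov
import Summits.Ventures.PercRepro2.HCovSwap
import Summits.Ventures.PercRepro2.RECMReduction
import Summits.Ventures.PercRepro2.GcTransport
import Summits.Ventures.PercRepro2.LeafLinearity
import Summits.Ventures.PercRepro2.LeafDelete
import Summits.Ventures.PercRepro2.PendantRootAll
import Summits.Ventures.PercRepro2.PendantRootReduction

/-!
# The leaf reduction of (HCOV) for the four marks `a₁, a₂, o, b` (blind cell PercRepro2, p5 g24;
`proofs/P5-OEDGE.md` §30 addendum 2)

`PendantRootReduction.lean` subtracts the leaf ROOTS; mine-2 g14's leaf linearity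
(`LeafLinearity.HCov_leaf_o_of` / `HCov_leaf_b_of`: `Gc(o leaf at x) = q · Gc(o := x)`) and p1 g8's leaf
deletion (`LeafDelete.HCov_update_loop`: re-pointing the leaf edge of an unmarked leaf to a loop
changes no mass of a marking avoiding it) subtract the leaves `o` and `b` at an UNMARKED vertex in
the same induction on `nonLoopCard`:

* **`HCov_leaf_o_loop`** / **`HCov_leaf_b_loop`**: `o` (resp. `b`) a leaf at an unmarked `x` through `f`;
  (HCOV) on the graph with `f` re-pointed to a loop, at the marking with `o := x` (resp. `b := x`),
  gives (HCOV) on `G` — a graph with one non-loop edge fewer;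
* the class **`NoUnmarkedLeaf`**: none of `a₁, a₂, o, b` is a leaf whose only edge goes to an unmarked
  vertex; **`HCovNL4_all`**; and **`HCov_all_of_noUnmarkedLeaf : HCovNL4_all → HCov_all`**.

A minimal counterexample to (HCOV) therefore has each of `a₁, a₂, o, b` of degree ≥ 2, isolated, or
attached by its only edge to a mark.  The leaf `a₃` at an unmarked vertex is NOT subtracted: it is
the open row (LEAF-½) (`LeafStep.LeafRow`).
-/

namespace Summit.Ventures.PercRepro2

open CovForm RECM LeafRoot

namespace LeafMark

section Steps

variable {V : Type*} {E : Type*} [Fintype E] [DecidableEq E] [Fintype V] [DecidableEq V]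
  {R : Type*} [Field R] [LinearOrder R] [IsStrictOrderedRing R]

omit [Fintype V] [DecidableEq V] in
/-- **`o` a leaf at an unmarked `x`**: (HCOV) on `G` with the leaf edge re-pointed to a loop, at the
marking `o := x`, gives (HCOV) on `G`. -/
theorem HCov_leaf_o_loop (p : E → R) (hp : IsProbVec p) {ends : E → Sym2 V} {f : E}
    {o a₁ a₂ a₃ b x : V} (hf : ends f = s(o, x)) (hleaf : ∀ e, o ∈ ends e → e = f)
    (hx : Unmarked o a₁ a₂ a₃ b x) (ho1 : o ≠ a₁) (ho2 : o ≠ a₂) (ho3 : o ≠ a₃) (hob : o ≠ b)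
    (h : HCov p (Function.update ends f s(o, o)) x a₁ a₂ a₃ b) : HCov p ends o a₁ a₂ a₃ b := by
  obtain ⟨hxo, hx1, hx2, hx3, hxb⟩ := hx
  have h' : HCov p ends x a₁ a₂ a₃ b :=
    (LeafDelete.HCov_update_loop p hf hleaf hxo.symm hxo ho1.symm ho2.symm ho3.symm hob.symm).1 h
  exact LeafLinearity.HCov_leaf_o_of p hp ends hf hleaf hxo.symm ho1 ho2 ho3 hob h'

omit [Fintype V] [DecidableEq V] in
/-- **`b` a leaf at an unmarked `x`**: (HCOV) on `G` with the leaf edge re-pointed to a loop, at the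
marking `b := x`, gives (HCOV) on `G`. -/
theorem HCov_leaf_b_loop (p : E → R) (hp : IsProbVec p) {ends : E → Sym2 V} {f : E}
    {o a₁ a₂ a₃ b x : V} (hf : ends f = s(b, x)) (hleaf : ∀ e, b ∈ ends e → e = f)
    (hx : Unmarked o a₁ a₂ a₃ b x) (hbo : b ≠ o) (hb1 : b ≠ a₁) (hb2 : b ≠ a₂) (hb3 : b ≠ a₃)
    (h : HCov p (Function.update ends f s(b, b)) o a₁ a₂ a₃ x) : HCov p ends o a₁ a₂ a₃ b := by
  obtain ⟨hxo, hx1, hx2, hx3, hxb⟩ := hx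
  have h' : HCov p ends o a₁ a₂ a₃ x :=
    (LeafDelete.HCov_update_loop p hf hleaf hxb.symm hbo.symm hb1.symm hb2.symm hb3.symm hxb).1 h
  exact LeafLinearity.HCov_leaf_b_of p hp ends hf hleaf hxb.symm hbo hb1 hb2 hb3 h'

end Steps

section Classes

variable {V : Type*} {E : Type*} [DecidableEq V]

/-- **The class `NoUnmarkedLeaf`**: none of the marks `a₁, a₂, o, b` is a leaf whose only edge reaches
an unmarked vertex. -/
def NoUnmarkedLeaf (ends : E → Sym2 V) (o a₁ a₂ a₃ b : V) : Prop :=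
  ∀ (e : E) (y : V), Unmarked o a₁ a₂ a₃ b y →
    ¬ (ends e = s(a₁, y) ∧ ∀ f, a₁ ∈ ends f → f = e) ∧
    ¬ (ends e = s(a₂, y) ∧ ∀ f, a₂ ∈ ends f → f = e) ∧
    ¬ (ends e = s(o, y) ∧ ∀ f, o ∈ ends f → f = e) ∧
    ¬ (ends e = s(b, y) ∧ ∀ f, b ∈ ends f → f = e)

end Classes

section Closure

variable (R : Type*) [Field R] [LinearOrder R] [IsStrictOrderedRing R]

/-- **(HCOV) on the class `NoUnmarkedLeaf`**. -/
def HCovNL4_all : Prop :=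
  ∀ (V E : Type) [Fintype V] [DecidableEq V] [Fintype E] [DecidableEq E]
    (ends : E → Sym2 V) (p : E → R), IsProbVec p →
    ∀ o a₁ a₂ a₃ b : V, a₁ ≠ a₂ → a₁ ≠ a₃ → a₂ ≠ a₃ → o ≠ a₁ → o ≠ a₂ → o ≠ a₃ → o ≠ b →
      b ≠ a₁ → b ≠ a₂ → b ≠ a₃ → NoUnmarkedLeaf ends o a₁ a₂ a₃ b → HCov p ends o a₁ a₂ a₃ b

end Closure

section Main

variable {R : Type*} [Field R] [LinearOrder R] [IsStrictOrderedRing R]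

/-- The leaf edge of a leaf at a different vertex is not a loop. -/
lemma not_isDiag_of_leaf {V E : Type*} {ends : E → Sym2 V} {e : E} {u y : V}
    (he : ends e = s(u, y)) (huy : u ≠ y) : ¬ (ends e).IsDiag := by
  rw [he]
  exact fun h => huy (Sym2.mk_isDiag_iff.mp h)

/-- **The four-mark leaf reduction, by strong induction on the number of non-loop edges**. -/
theorem HCov_of_noUnmarkedLeaf {V E : Type} [Fintype V] [DecidableEq V] [Fintype E]
    [DecidableEq E] (hB : HCovNL4_all R) (n : ℕ) :
    ∀ (ends : E → Sym2 V), nonLoopCard ends = n → ∀ (p : E → R), IsProbVec p →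
      ∀ o a₁ a₂ a₃ b : V, a₁ ≠ a₂ → a₁ ≠ a₃ → a₂ ≠ a₃ → o ≠ a₁ → o ≠ a₂ → o ≠ a₃ → o ≠ b →
        b ≠ a₁ → b ≠ a₂ → b ≠ a₃ → HCov p ends o a₁ a₂ a₃ b := by
  induction n using Nat.strong_induction_on with
  | _ n ih =>
  intro ends hn p hp o a₁ a₂ a₃ b h12 h13 h23 ho1 ho2 ho3 hob hb1 hb2 hb3
  by_cases h1 : ∃ (e : E) (y : V), Unmarked o a₁ a₂ a₃ b y ∧
      (ends e = s(a₁, y) ∧ ∀ f, a₁ ∈ ends f → f = e)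
  · obtain ⟨e, y, hy, he, hleaf⟩ := h1
    have hlt : nonLoopCard (contractRootEdge ends a₁ y) < n :=
      hn ▸ nonLoopCard_contract_lt ends hy.2.1.symm he
    have hIH := ih _ hlt (contractRootEdge ends a₁ y) rfl p hp o a₁ a₂ a₃ b h12 h13 h23 ho1 ho2
      ho3 hob hb1 hb2 hb3
    exact HCov_pendant_root_contract' p hp he hleaf hy ho1 h12.symm h13.symm hb1 hIH
  by_cases h2 : ∃ (e : E) (y : V), Unmarked o a₁ a₂ a₃ b y ∧
      (ends e = s(a₂, y) ∧ ∀ f, a₂ ∈ ends f → f = e)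
  · obtain ⟨e, y, hy, he, hleaf⟩ := h2
    have hlt : nonLoopCard (contractRootEdge ends a₂ y) < n :=
      hn ▸ nonLoopCard_contract_lt ends hy.2.2.1.symm he
    have hIH := ih _ hlt (contractRootEdge ends a₂ y) rfl p hp o a₁ a₂ a₃ b h12 h13 h23 ho1 ho2
      ho3 hob hb1 hb2 hb3
    exact HCov_pendant_root_contract p hp he hleaf hy ho2 h12 h23.symm hb2 hIH
  by_cases h3 : ∃ (e : E) (y : V), Unmarked o a₁ a₂ a₃ b y ∧
      (ends e = s(o, y) ∧ ∀ f, o ∈ ends f → f = e)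
  · -- `o` is a leaf at an unmarked `y`: re-point its edge to a loop, move the mark to `y`
    obtain ⟨e, y, hy, he, hleaf⟩ := h3
    have hlt : nonLoopCard (Function.update ends e s(o, o)) < n :=
      hn ▸ nonLoopCard_update_loop_lt ends (not_isDiag_of_leaf he hy.1.symm) o
    have hIH := ih _ hlt (Function.update ends e s(o, o)) rfl p hp y a₁ a₂ a₃ b h12 h13 h23
      hy.2.1 hy.2.2.1 hy.2.2.2.1 hy.2.2.2.2 hb1 hb2 hb3
    exact HCov_leaf_o_loop p hp he hleaf hy ho1 ho2 ho3 hob hIH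
  by_cases h4 : ∃ (e : E) (y : V), Unmarked o a₁ a₂ a₃ b y ∧
      (ends e = s(b, y) ∧ ∀ f, b ∈ ends f → f = e)
  · -- `b` is a leaf at an unmarked `y`
    obtain ⟨e, y, hy, he, hleaf⟩ := h4
    have hlt : nonLoopCard (Function.update ends e s(b, b)) < n :=
      hn ▸ nonLoopCard_update_loop_lt ends (not_isDiag_of_leaf he hy.2.2.2.2.symm) b
    have hIH := ih _ hlt (Function.update ends e s(b, b)) rfl p hp o a₁ a₂ a₃ y h12 h13 h23
      ho1 ho2 ho3 hy.1.symm hy.2.1 hy.2.2.1 hy.2.2.2.1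
    exact HCov_leaf_b_loop p hp he hleaf hy hob.symm hb1 hb2 hb3 hIH
  · -- none of `a₁, a₂, o, b` is a leaf at an unmarked vertex: the class
    apply hB V E ends p hp o a₁ a₂ a₃ b h12 h13 h23 ho1 ho2 ho3 hob hb1 hb2 hb3
    intro e y hy
    exact ⟨fun h => h1 ⟨e, y, hy, h⟩, fun h => h2 ⟨e, y, hy, h⟩, fun h => h3 ⟨e, y, hy, h⟩,
      fun h => h4 ⟨e, y, hy, h⟩⟩

/-- **THE FOUR-MARK LEAF REDUCTION OF (HCOV)**: `HCovNL4_all → HCov_all` — (HCOV) for every finite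
weighted graph follows from (HCOV) on the graphs in which none of `a₁, a₂, o, b` is a leaf at an
unmarked vertex. -/
theorem HCov_all_of_noUnmarkedLeaf (hB : HCovNL4_all R) : HCov_all R := by
  intro V E _ _ _ _ ends p hp o a₁ a₂ a₃ b h12 h13 h23 ho1 ho2 ho3 hob hb1 hb2 hb3
  exact HCov_of_noUnmarkedLeaf hB _ ends rfl p hp o a₁ a₂ a₃ b h12 h13 h23 ho1 ho2 ho3 hob hb1
    hb2 hb3

end Main

end LeafMark

end Summit.Ventures.PercRepro2
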